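import Mathlib.Topology.Subpath
import Literature.AlgebraicTopology.FundamentalGroup.RetractionCriteria
import Literature.Topology.FourManifolds.SmallSetComplementSimplyConnected

/-!
# Helper `helper_friendsPi1_G3` (loops off the core), aux file 1: pushing a path off a set, piece by piece
(sub-goal G3 of stub `stub_friendsPi1`, line `mk_friends`, crux `DcrGap`;
item stmt-SmoothPoincare4-16128, route route-SmoothPoincare4-DottedCircleRasmussen)

Sub-goal G3 of the simple-connectivity stub says: in the closed `4`-manifold `X ⊃ C = i(D_k) ∪ f₀(𝔻²)`
every loop based off the core `C` is homotopic to a loop off `C`.  The proof (main file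
`…HelperFriendsPi1G3.lean`) moves the loop off `C` piece by piece, and this file supplies the
general-topology half of that argument:

* `exists_path_forall_notMem_of_cover` — **the path-cover lemma** (the decomposition in Hatcher's proof
  of van Kampen's theorem, *Algebraic Topology* (2002), Lemma 1.15): if `Z` is covered by open sets `V i`
  such that (1) every point of `C` in `V i ∩ V j` is joined inside `V i ∩ V j` to a point off `C`, and
  (2) every path inside one `V i` with end points off `C` is homotopic rel end points to a path off
  `C`, then every path with end points off `C` is homotopic rel end points to a path off `C`
  (Lebesgue subdivision, anchors at the cut points, piecewise replacement);
* `exists_path_homotopicWithin_forall_notMem` — **general position for paths in codimension `≥ 2`**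
  in an open subset `W` of a finite-dimensional real vector space: a path in `W` with end points off a
  set `T` covered by countably many `C¹` images of a parameter space of dimension `≤ dim - 2` is
  homotopic within `W` to a path in `W ∖ T` (the cover lemma in `W` with balls, rejoined off `T` by
  the two-segment paths of `SmallSet.joinedIn_diff`, Hurewicz–Wallman (1941), Thm. IV 4);
* `exists_path_of_homotopicWithin` — transport of a homotopy within `Ω` along a map continuous on `Ω`
  (used with the germ chart `i` and with the inverse charts of `X`);
* the registered helper `helper_friendsPi1_G3_cover` (the cover lemma at universe `0`).

Everything is proved; no definitions, no named facts, no `sorry`.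

## References

* A. Hatcher, *Algebraic Topology*, CUP (2002), §1.2, proof of Lemma 1.15. [HatcherAT2002]
* W. Hurewicz, H. Wallman, *Dimension Theory*, Princeton (1941), Ch. IV §5, Thm. IV 4. [HurewiczWallman1941]
-/

-- the prescribed namespace `Summit.<P>.<Sub>.…` duplicates `SmoothPoincare4` (P = Sub)
set_option linter.dupNamespace false
set_option linter.style.longLine false

noncomputable section

open scoped Topology unitInterval
open Set Function Metric Module
open Literature.AlgebraicTopology.FundamentalGroup Literature.Topology.FourManifolds
open Literature.AlgebraicTopology.FundamentalGroup.VanKampen (HomotopicWithin liftPath)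

namespace Summit.SmoothPoincare4.SmoothPoincare4.Theorems.DcrGap.MkFriends

namespace FriendsPi1

universe u v

/-! ## Path bookkeeping -/

section Paths

variable {Z : Type u} [TopologicalSpace Z]

/-- Points of a subpath. [folklore] -/
theorem subpath_apply {a b : Z} (γ : Path a b) (t₀ t₁ s : I) :
    γ.subpath t₀ t₁ s = γ (Set.Icc.convexComb t₀ t₁ s) := rfl

/-- Every point of a subpath `γ|[t₀, t₁]` (`t₀ ≤ t₁`) is a point `γ t` with `t₀ ≤ t ≤ t₁`. [folklore] -/
theorem subpath_mem {a b : Z} (γ : Path a b) {t₀ t₁ : I} (h : t₀ ≤ t₁) {S : Set Z}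
    (hS : ∀ t, t₀ ≤ t → t ≤ t₁ → γ t ∈ S) (s : I) : γ.subpath t₀ t₁ s ∈ S := by
  have hmem : γ.subpath t₀ t₁ s ∈ range (γ.subpath t₀ t₁) := mem_range_self s
  rw [Path.range_subpath_of_le γ t₀ t₁ h] at hmem
  obtain ⟨t, ht, hts⟩ := hmem
  rw [← hts]
  exact hS t ht.1 ht.2

/-- Every point of a concatenation is a point of one of the two paths. [folklore] -/
theorem trans_mem' {a b c : Z} {p : Path a b} {q : Path b c} {P : Z → Prop} (hp : ∀ t, P (p t))
    (hq : ∀ t, P (q t)) (t : I) : P (p.trans q t) :=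
  VanKampen.trans_mem (S := {z | P z}) hp hq t

/-- Casting both paths along the same end-point equalities does not change homotopy. [folklore] -/
theorem homotopic_cast_iff {a a' b b' : Z} (p q : Path a b) (ha : a' = a) (hb : b' = b) :
    (p.cast ha hb).Homotopic (q.cast ha hb) ↔ p.Homotopic q := by
  subst ha hb
  rfl

/-- `γ|[0, t₁] · γ|[t₁, t₂] ≃ γ|[0, t₂]`, with the source recast. [folklore] -/
theorem cast_subpath_trans_subpath {a b x : Z} (γ : Path a b) (hx : x = γ 0) (t₁ t₂ : I) :
    (((γ.subpath 0 t₁).cast hx rfl).trans (γ.subpath t₁ t₂)).Homotopic ((γ.subpath 0 t₂).cast hx rfl) := by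
  subst hx
  exact ⟨Path.Homotopy.subpathTransSubpath γ 0 t₁ t₂⟩

/-- `γ|[0, 1]` followed by a constant path is `γ · refl`, as paths. [folklore] -/
theorem cast_subpath_trans_const_eq {a b : Z} (γ : Path a b) (δ : Path (γ 1) b)
    (hδ : ∀ s, δ s = γ 1) :
    ((γ.subpath 0 1).cast γ.source.symm rfl).trans δ = γ.trans (Path.refl b) := by
  ext s
  rw [Path.trans_apply, Path.trans_apply]
  split_ifs with h
  · rw [Path.cast_coe, subpath_apply, Set.Icc.convexComb_zero_one]
  · rw [hδ, γ.target]; rfl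

/-- **Transport of a homotopy within `Ω` along a map continuous on `Ω`.** [folklore] -/
theorem homotopic_map'_of_homotopicWithin {X : Type v} [TopologicalSpace X] {Ω : Set Z} {f : Z → X}
    (hf : ContinuousOn f Ω) {a b : Z} {p q : Path a b} (h : HomotopicWithin Ω p q)
    (hp : ∀ t, p t ∈ Ω) (hq : ∀ t, q t ∈ Ω) :
    (p.map' (hf.mono (range_subset_iff.2 hp))).Homotopic (q.map' (hf.mono (range_subset_iff.2 hq))) := by
  obtain ⟨F, hF⟩ := h
  exact ⟨{ toFun := fun z => f (F z)
           continuous_toFun := hf.comp_continuous F.continuous hF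
           map_zero_left := fun t => by
             change f (F (0, t)) = f (p t)
             rw [F.apply_zero]; rfl
           map_one_left := fun t => by
             change f (F (1, t)) = f (q t)
             rw [F.apply_one]; rfl
           prop' := fun s t ht => by
             change f (F (s, t)) = f (p t)
             rw [F.eq_fst s ht]; rfl }⟩

/-- **Transport of a homotopy within `Ω` to a path given through `f`.**  If `p ≃ q` within `Ω`, `f` is
continuous on `Ω`, and `β` is a path with `β s = f (p s)`, then `β` is homotopic rel end points to a
path `β'` with `β' s = f (q s)` (the previous lemma, with the end-point casts discharged). [folklore] -/
theorem exists_path_of_homotopicWithin {X : Type v} [TopologicalSpace X] {Ω : Set Z} {f : Z → X}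
    (hf : ContinuousOn f Ω) {a b : Z} {p q : Path a b} (h : HomotopicWithin Ω p q)
    {a' b' : X} (β : Path a' b') (hβ : ∀ s, β s = f (p s)) :
    ∃ β' : Path a' b', (∀ s, β' s = f (q s)) ∧ β.Homotopic β' := by
  have hp : ∀ t, p t ∈ Ω := h.left_mem
  have hq : ∀ t, q t ∈ Ω := h.right_mem
  have ha : a' = f a := by rw [← β.source, hβ, p.source]
  have hb : b' = f b := by rw [← β.target, hβ, p.target]
  have H := homotopic_map'_of_homotopicWithin hf h hp hq
  refine ⟨(q.map' (hf.mono (range_subset_iff.2 hq))).cast ha hb, fun s => rfl, ?_⟩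
  have e : β = (p.map' (hf.mono (range_subset_iff.2 hp))).cast ha hb := by
    ext s
    rw [hβ s]
    rfl
  rw [e, homotopic_cast_iff]
  exact H

end Paths

/-! ## The path-cover lemma -/

section Cover

variable {Z : Type u} [TopologicalSpace Z]

/-- **Pushing a path off a set `C`, piece by piece.**  Let `V i` be open sets of `Z` such that
(1) every point of `C` in `V i ∩ V j` is joined inside `V i ∩ V j` to a point off `C`, and (2) every
path inside one `V i` with end points off `C` is homotopic (rel end points, in `Z`) to a path off
`C`.  Then every path covered by the `V i` with end points off `C` is homotopic to a path off `C`: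
cut the path at a Lebesgue subdivision, join the cut points lying on `C` to points off `C` inside
the relevant `V i ∩ V j` by (1), and replace each piece `δᵢ⁻¹ · γ|[tᵢ, tᵢ₊₁] · δᵢ₊₁` by (2) (the
decomposition of Hatcher, *Algebraic Topology*, proof of Lemma 1.15). [cite: HatcherAT2002, Lemma 1.15] -/
theorem exists_path_forall_notMem_of_cover {ι : Type v} {C : Set Z} {V : ι → Set Z}
    (hVo : ∀ i, IsOpen (V i))
    (h1 : ∀ i j p, p ∈ C → p ∈ V i → p ∈ V j → ∃ q, q ∉ C ∧ ∃ δ : Path p q, ∀ s, δ s ∈ V i ∧ δ s ∈ V j)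
    (h2 : ∀ i {p q : Z} (β : Path p q), (∀ s, β s ∈ V i) → p ∉ C → q ∉ C →
      ∃ β' : Path p q, (∀ s, β' s ∉ C) ∧ β.Homotopic β')
    {x y : Z} (γ : Path x y) (hγ : ∀ t, ∃ i, γ t ∈ V i) (hx : x ∉ C) (hy : y ∉ C) :
    ∃ γ' : Path x y, (∀ s, γ' s ∉ C) ∧ γ.Homotopic γ' := by
  -- Lebesgue subdivision
  obtain ⟨t, ht0, htm, ⟨M, hM⟩, hcov⟩ := exists_monotone_Icc_subset_open_cover_unitInterval
    (c := fun i => γ ⁻¹' V i) (fun i => (hVo i).preimage γ.continuous)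
    (fun s _ => mem_iUnion.2 (hγ s))
  choose α hα using hcov
  have hmemR : ∀ n, γ (t n) ∈ V (α n) := fun n => hα n ⟨le_rfl, htm n.le_succ⟩
  have hmemL : ∀ n, γ (t (n + 1)) ∈ V (α n) := fun n => hα n ⟨htm n.le_succ, le_rfl⟩
  have hsub : ∀ n s, γ.subpath (t n) (t (n + 1)) s ∈ V (α n) := fun n =>
    subpath_mem γ (htm n.le_succ) fun s h₁ h₂ => hα n ⟨h₁, h₂⟩
  -- anchors at the cut points
  have hanc : ∀ n, ∃ q, q ∉ C ∧ ∃ δ : Path (γ (t n)) q, (∀ s, δ s ∈ V (α n)) ∧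
      (∀ s, n ≠ 0 → δ s ∈ V (α (n - 1))) ∧ (γ (t n) ∉ C → ∀ s, δ s = γ (t n)) := by
    intro n
    by_cases hc : γ (t n) ∈ C
    · obtain _ | n := n
      · exact absurd (by rwa [ht0, γ.source] at hc) hx
      · obtain ⟨q, hq, δ, hδ⟩ := h1 (α (n + 1)) (α n) _ hc (hmemR (n + 1)) (hmemL n)
        exact ⟨q, hq, δ, fun s => (hδ s).1, fun s _ => by simpa using (hδ s).2,
          fun h => absurd hc h⟩
    · refine ⟨γ (t n), hc, Path.refl _, fun _ => hmemR n, fun s hn => ?_, fun _ _ => rfl⟩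
      obtain _ | n := n
      · exact absurd rfl hn
      · simpa using hmemL n
  choose q hqC δ hδR hδL hδc using hanc
  -- the pieces, pushed off `C` one at a time
  have key : ∀ n, ∃ η : Path x (q n), (∀ s, η s ∉ C) ∧
      (((γ.subpath 0 (t n)).cast γ.source.symm rfl).trans (δ n)).Homotopic η := by
    intro n
    induction n with
    | zero =>
      have h0 : ∀ s, ((γ.subpath 0 (t 0)).cast γ.source.symm rfl) s = x := fun s => by
        rw [Path.cast_coe, subpath_apply, ht0, Set.Icc.convexComb_eq, γ.source]
      have hx0 : γ (t 0) = x := by rw [ht0, γ.source]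
      have hxC : γ (t 0) ∉ C := by rw [hx0]; exact hx
      refine ⟨_, trans_mem' (P := fun z => z ∉ C) (fun s => by rw [h0 s]; exact hx)
        (fun s => by rw [hδc 0 hxC s]; exact hxC), Path.Homotopic.refl _⟩
    | succ n ih =>
      obtain ⟨η, hηC, hη⟩ := ih
      set β : Path (q n) (q (n + 1)) :=
        ((δ n).symm.trans (γ.subpath (t n) (t (n + 1)))).trans (δ (n + 1)) with hβ
      have hβV : ∀ s, β s ∈ V (α n) :=
        trans_mem' (P := fun z => z ∈ V (α n)) (trans_mem' (P := fun z => z ∈ V (α n))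
          (fun s => hδR n _) (hsub n)) fun s => by simpa using hδL (n + 1) s n.succ_ne_zero
      obtain ⟨β', hβ'C, hββ'⟩ := h2 (α n) β hβV (hqC n) (hqC (n + 1))
      refine ⟨η.trans β', trans_mem' (P := fun z => z ∉ C) hηC hβ'C, ?_⟩
      have hcut := cast_subpath_trans_subpath γ γ.source.symm (t n) (t (n + 1))
      rw [← Path.Homotopic.Quotient.eq] at hη hββ' hcut ⊢
      simp only [Path.Homotopic.Quotient.mk_trans] at hη hββ' hcut ⊢
      rw [← hη, ← hββ', ← hcut, hβ]
      simp only [Path.Homotopic.Quotient.mk_trans, Path.Homotopic.Quotient.mk_symm,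
        Path.Homotopic.Quotient.trans_assoc]
      rw [← Path.Homotopic.Quotient.trans_assoc (Path.Homotopic.Quotient.mk (δ n)),
        Path.Homotopic.Quotient.trans_symm, Path.Homotopic.Quotient.refl_trans]
  -- the last piece ends at `y`
  obtain ⟨η, hηC, hη⟩ := key M
  have hM1 : t M = 1 := hM M le_rfl
  have hyC : γ (t M) ∉ C := by rw [hM1, γ.target]; exact hy
  have hq : y = q M := by rw [← (δ M).target, hδc M hyC, hM1, γ.target]
  refine ⟨η.cast rfl hq, fun s => hηC s, ?_⟩
  -- bookkeeping: `γ|[0,1] · const ≃ γ`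
  have aux : ∀ (T : I) (hT : T = 1) (q' : Z) (δ' : Path (γ T) q') (hδ' : ∀ s, δ' s = γ T)
      (η' : Path x q') (hη' : (((γ.subpath 0 T).cast γ.source.symm rfl).trans δ').Homotopic η')
      (hq' : y = q'), γ.Homotopic (η'.cast rfl hq') := by
    intro T hT q' δ' hδ' η' hη' hq'
    subst hT hq'
    rw [cast_subpath_trans_const_eq γ δ' hδ'] at hη'
    exact (Path.Homotopic.trans_refl γ).symm.trans hη'
  exact aux (t M) hM1 (q M) (δ M) (hδc M hyC) η hη hq

end Cover

/-! ## General position for paths in a Euclidean open set (codimension `≥ 2`) -/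

section Euclid

variable {E : Type*} [NormedAddCommGroup E] [NormedSpace ℝ E]

/-- Two paths with the same end points inside a convex set are homotopic within it (straight-line
homotopy). [folklore] -/
theorem homotopicWithin_of_convex {S : Set E} (hS : Convex ℝ S) {a b : E} (p q : Path a b)
    (hp : ∀ t, p t ∈ S) (hq : ∀ t, q t ∈ S) : HomotopicWithin S p q := by
  refine ⟨{ toFun := fun z => (1 - (z.1 : ℝ)) • p z.2 + (z.1 : ℝ) • q z.2
            continuous_toFun := by fun_prop
            map_zero_left := fun t => by simp
            map_one_left := fun t => by simp
            prop' := fun s t ht => ?_ }, fun z => ?_⟩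
  · simp only [mem_insert_iff, mem_singleton_iff] at ht
    show (1 - (s : ℝ)) • p t + (s : ℝ) • q t = p t
    rcases ht with rfl | rfl
    · simp [← add_smul]
    · simp [← add_smul]
  · exact hS (hp z.2) (hq z.2) (by linarith [z.1.2.2]) z.1.2.1 (by ring)

variable [FiniteDimensional ℝ E] {P : Type*} [NormedAddCommGroup P] [NormedSpace ℝ P]
  [FiniteDimensional ℝ P]

/-- **General position for paths, codimension `≥ 2`.**  Let `T ⊆ E` be covered by countably many
`C¹` images of open subsets of `P`, `dim P + 2 ≤ dim E`, and `W ⊆ E` open.  Every path in `W` with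
end points off `T` is homotopic within `W` (rel end points) to a path in `W ∖ T`: cut the path into
pieces lying in balls of `W`, move the cut points off `T` (dense complement) and rejoin inside each
ball off `T` by the two-segment paths of `SmallSet.joinedIn_diff` (Hurewicz–Wallman 1941,
Thm. IV 4: a closed set of dimension `≤ n - 2` does not separate, locally).
[cite: HurewiczWallman1941, Ch. IV §5, Thm. IV 4 and Cor. 1] -/
theorem exists_path_homotopicWithin_forall_notMem (hdim : finrank ℝ P + 2 ≤ finrank ℝ E)
    {ι : Type*} [Countable ι] {T : Set E} (h : ι → P → E) (O : ι → Set P)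
    (hO : ∀ i, IsOpen (O i)) (hh : ∀ i, ContDiffOn ℝ 1 (h i) (O i)) (hT : T ⊆ ⋃ i, h i '' O i)
    {W : Set E} (hW : IsOpen W) {a b : E} (β : Path a b) (hβ : ∀ s, β s ∈ W) (ha : a ∉ T)
    (hb : b ∉ T) : ∃ β' : Path a b, (∀ s, β' s ∈ W ∧ β' s ∉ T) ∧ HomotopicWithin W β β' := by
  have hdense : Dense Tᶜ := SmallSet.dense_compl (by omega) h O hO hh hT
  -- the cover of the subspace `W` by the balls inside `W`
  let κ := {c : E × ℝ // ball c.1 c.2 ⊆ W}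
  let V : κ → Set ↥W := fun c => Subtype.val ⁻¹' ball c.1.1 c.1.2
  have hVo : ∀ c, IsOpen (V c) := fun c => isOpen_ball.preimage continuous_subtype_val
  have h1 : ∀ c c' (p : ↥W), p ∈ (Subtype.val ⁻¹' T : Set ↥W) → p ∈ V c → p ∈ V c' →
      ∃ q, q ∉ (Subtype.val ⁻¹' T : Set ↥W) ∧ ∃ δ : Path p q, ∀ s, δ s ∈ V c ∧ δ s ∈ V c' := by
    intro c c' p _ hp hp'
    obtain ⟨z, hzT, hzB⟩ := hdense.exists_mem_open (isOpen_ball.inter isOpen_ball) ⟨(p : E), hp, hp'⟩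
    have hseg : segment ℝ (p : E) z ⊆ ball c.1.1 c.1.2 ∩ ball c'.1.1 c'.1.2 :=
      ((convex_ball _ _).inter (convex_ball _ _)).segment_subset ⟨hp, hp'⟩ hzB
    set δE := (JoinedIn.of_segment_subset hseg).somePath with hδE
    have hδEm : ∀ s, δE s ∈ ball c.1.1 c.1.2 ∩ ball c'.1.1 c'.1.2 := (JoinedIn.of_segment_subset hseg).somePath_mem
    have hδEW : ∀ s, δE s ∈ W := fun s => c.2 (hδEm s).1
    exact ⟨⟨z, c.2 hzB.1⟩, hzT, liftPath W δE hδEW, fun s => hδEm s⟩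
  have h2 : ∀ c {p q : ↥W} (β : Path p q), (∀ s, β s ∈ V c) → p ∉ (Subtype.val ⁻¹' T : Set ↥W) →
      q ∉ (Subtype.val ⁻¹' T : Set ↥W) →
      ∃ β' : Path p q, (∀ s, β' s ∉ (Subtype.val ⁻¹' T : Set ↥W)) ∧ β.Homotopic β' := by
    intro c p q β hβc hp hq
    set βE := β.map continuous_subtype_val with hβE
    have hj := SmallSet.joinedIn_diff hdim h O hO hh hT (convex_ball c.1.1 c.1.2) isOpen_ball
      (x := (p : E)) (y := (q : E)) ⟨by have := hβc 0; rwa [β.source] at this, hp⟩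
      ⟨by have := hβc 1; rwa [β.target] at this, hq⟩
    set β₁ := hj.somePath with hβ₁
    have hβ₁m : ∀ s, β₁ s ∈ ball c.1.1 c.1.2 \ T := hj.somePath_mem
    have hβ₁W : ∀ s, β₁ s ∈ W := fun s => c.2 (hβ₁m s).1
    have hβEW : ∀ s, βE s ∈ W := fun s => (β s).2
    have hhom : HomotopicWithin W βE β₁ :=
      (homotopicWithin_of_convex (convex_ball c.1.1 c.1.2) βE β₁ (fun s => hβc s)
        fun s => (hβ₁m s).1).mono c.2
    refine ⟨liftPath W β₁ hβ₁W, fun s => (hβ₁m s).2, ?_⟩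
    have e : liftPath W βE hβEW = β := by ext s; rfl
    simpa [e] using hhom.liftPath hβEW hβ₁W
  -- apply the cover lemma in `W`
  have hcov : ∀ s, ∃ c, liftPath W β hβ s ∈ V c := fun s => by
    obtain ⟨r, hr, hrW⟩ := Metric.isOpen_iff.1 hW (β s) (hβ s)
    exact ⟨⟨(β s, r), hrW⟩, mem_ball_self hr⟩
  obtain ⟨γ', hγ'T, hγγ'⟩ := exists_path_forall_notMem_of_cover (Z := ↥W) hVo h1 h2
    (liftPath W β hβ) hcov ha hb
  refine ⟨γ'.map continuous_subtype_val, fun s => ⟨(γ' s).2, hγ'T s⟩, ?_⟩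
  have hm : ∀ s, γ'.map continuous_subtype_val s ∈ W := fun s => (γ' s).2
  rw [homotopicWithin_iff_liftPath hβ hm]
  have e : liftPath W (γ'.map continuous_subtype_val) hm = γ' := by ext s; rfl
  rwa [e]

end Euclid

end FriendsPi1

/-- **The path-cover lemma** (registered helper `helper_friendsPi1_G3_cover`, aux part 1 of sub-goal G3
of `stub_friendsPi1`): if `Z` is covered by open sets `V i` such that every point of `C` in
`V i ∩ V j` is joined inside `V i ∩ V j` to a point off `C`, and every path inside one `V i` with end
points off `C` is homotopic rel end points to a path off `C`, then every path with end points off `C`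
is homotopic rel end points to a path off `C` (Hatcher 2002, proof of Lemma 1.15).
[cite: HatcherAT2002, Lemma 1.15] -/
theorem helper_friendsPi1_G3_cover : ∀ (Z : Type) [TopologicalSpace Z] (ι : Type) (C : Set Z) (V : ι → Set Z), (∀ i, IsOpen (V i)) → (∀ i j (p : Z), p ∈ C → p ∈ V i → p ∈ V j → ∃ q : Z, q ∉ C ∧ ∃ δ : Path p q, ∀ s, δ s ∈ V i ∧ δ s ∈ V j) → (∀ i (p q : Z) (β : Path p q), (∀ s, β s ∈ V i) → p ∉ C → q ∉ C → ∃ β' : Path p q, (∀ s, β' s ∉ C) ∧ β.Homotopic β') → ∀ (x y : Z) (γ : Path x y), (∀ t, ∃ i, γ t ∈ V i) → x ∉ C → y ∉ C → ∃ γ' : Path x y, (∀ s, γ' s ∉ C) ∧ γ.Homotopic γ' :=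
  fun _ _ _ _ _ hVo h1 h2 _ _ γ hγ hx hy =>
    FriendsPi1.exists_path_forall_notMem_of_cover hVo h1 (fun i _ _ β => h2 i _ _ β) γ hγ hx hy

end Summit.SmoothPoincare4.SmoothPoincare4.Theorems.DcrGap.MkFriends

end
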